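import Mathlib
import HarnessLib
import Summits.PneNP.PneNP.Theorems.AeaCutRectanglesFibreBound
import Literature.Barriers.PneNP.TSPExtensionComplexityRothvossAssembly

/-!
# Crux `FoolingMeasure` (stmt-PneNP-19727): SPARSE WITNESSES — superset rectangles, sparse fibres, counting

Engine file of the lead prover (pnp-aea-p1 g2, 2026-08-27) for two refuted weakenings of the crux X1
`Summit.PneNP.PneNP.Theses.AeaCutRectangles.FoolingMeasure` of route `AeaCutRectangles` (the headline
theorems are in `AeaCutRectanglesNoSparseSupports`).  X1 asks for probability measures `μ` on loopless
non-3-colourable edge sets over `Fin n` all of whose cut rectangles `𝓐 ⊗ 𝓑` over near-balanced cuts `B`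
(Alice: edges meeting `Fin n ∖ B`; Bob: edges inside `B`) have mass `≤ δ = 2^{-(n/2)·log₂ n - C·n}`.
Two families of cheap rectangles and the union bound shrink the space of candidate supports:

* SUPERSET RECTANGLES (`supset_sum_le_rect`, `supset_le_of_rectClause`): for ANY non-3-colourable edge set
  `H`, the supersets of `H` carrying mass give a cut rectangle inside NON-3-COL over every cut (Alice parts =
  their outside parts, Bob parts = their inside parts; every union contains `H`), so X1's clause forces
  `μ{G ⊇ H} ≤ δ`; union bound over all `H` with `≤ m` edges: `total_le_of_sparseObstructions`.
* SPARSE FIBRES (`sparseBob_le`, `total_le_of_sparseHalf`; the Bob-fibres of `AeaCutRectanglesFibreBound`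
  summed over the inside parts with `≤ m` edges, then over the `≤ 2^n` cuts of a window).
* COUNTING (`card_filter_card_le`, `card_small_edgeSets_le`: at most `(m+1)·(n²)^m` edge sets with `≤ m`
  edges; `|Sym2 (Fin n)| ≤ n²` is reused from `Literature.Barriers.PneNP.card_sym2_fin_le`) and THRESHOLD
  ARITHMETIC (`count_mul_threshold_lt_one`: `(m+1)(n²)^m · 2^{-(n/2)·log₂ n} < 1` as
  soon as `4(m+1) ≤ n`); `K4_not_colorable`.

HONEST FRAMING: elementary counting and bookkeeping; FRONTIER material for a rung of Fagin's complement
ladder (NON-3-COL vs ESO(∀∃∀)); a restricted-model witness — nothing here bears on P vs NP.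
-/
set_option linter.dupNamespace false
set_option autoImplicit false

namespace Summit.PneNP.PneNP.Theorems.AeaCutRectanglesSparseWitnesses

open Finset
open Summit.PneNP.PneNP.Theorems.AeaCutRectanglesDutyRectangles
open Summit.PneNP.PneNP.Theorems.AeaCutRectanglesFibreBound

/-! ### A union-bound device and a counting lemma -/

/-- **Union bound.**  If `f ≥ 0` and every point of non-zero `f`-mass satisfies `p i ·` for some `i ∈ I`, then
the total `f`-mass is at most the sum over `i ∈ I` of the `f`-masses of `{x | p i x}`. -/
theorem sum_le_sum_cover {ι X : Type*} [Fintype X] (I : Finset ι) (p : ι → X → Prop)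
    [∀ i x, Decidable (p i x)] (f : X → ℝ) (hf : ∀ x, 0 ≤ f x)
    (hcov : ∀ x, f x ≠ 0 → ∃ i ∈ I, p i x) :
    ∑ x, f x ≤ ∑ i ∈ I, ∑ x ∈ univ.filter (p i), f x := by
  have key : ∀ x, f x ≤ ∑ i ∈ I, if p i x then f x else 0 := by
    intro x
    by_cases hx : f x = 0
    · rw [hx]
      exact sum_nonneg fun i _ => by split_ifs <;> exact le_rfl
    · obtain ⟨i, hi, hpx⟩ := hcov x hx
      calc f x = ∑ j ∈ ({i} : Finset ι), (if p j x then f x else 0) := by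
            rw [sum_singleton, if_pos hpx]
        _ ≤ ∑ j ∈ I, (if p j x then f x else 0) := by
            apply sum_le_sum_of_subset_of_nonneg (singleton_subset_iff.2 hi)
            intro j _ _
            split_ifs
            · exact hf x
            · exact le_rfl
  calc ∑ x, f x ≤ ∑ x, ∑ i ∈ I, (if p i x then f x else 0) := sum_le_sum fun x _ => key x
    _ = ∑ i ∈ I, ∑ x, (if p i x then f x else 0) := sum_comm
    _ = ∑ i ∈ I, ∑ x ∈ univ.filter (p i), f x := by
        refine sum_congr rfl fun i _ => ?_
        rw [sum_filter]

/-- **Counting small sets.**  A finite type with `N ≥ 1` elements has at most `(m+1)·N^m` subsets of size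
`≤ m` (crude form of `∑_{j ≤ m} C(N,j)`; Stirling would give `(eN/m)^m`). -/
theorem card_filter_card_le (α : Type*) [Fintype α] [DecidableEq α] (m : ℕ) (hα : 1 ≤ Fintype.card α) :
    ((univ : Finset (Finset α)).filter (fun s => s.card ≤ m)).card ≤ (m + 1) * (Fintype.card α) ^ m := by
  have hsub : (univ : Finset (Finset α)).filter (fun s => s.card ≤ m) ⊆
      (range (m + 1)).biUnion (fun j => powersetCard j (univ : Finset α)) := by
    intro s hs
    rw [mem_biUnion]
    exact ⟨s.card, mem_range.2 (Nat.lt_succ_of_le (mem_filter.1 hs).2),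
      mem_powersetCard.2 ⟨subset_univ _, rfl⟩⟩
  calc ((univ : Finset (Finset α)).filter (fun s => s.card ≤ m)).card
      ≤ ((range (m + 1)).biUnion (fun j => powersetCard j (univ : Finset α))).card := card_le_card hsub
    _ ≤ ∑ j ∈ range (m + 1), (powersetCard j (univ : Finset α)).card := card_biUnion_le
    _ ≤ ∑ _j ∈ range (m + 1), (Fintype.card α) ^ m := by
        refine sum_le_sum fun j hj => ?_
        rw [card_powersetCard, card_univ]
        calc (Fintype.card α).choose j ≤ (Fintype.card α) ^ j := Nat.choose_le_pow _ _
          _ ≤ (Fintype.card α) ^ m := Nat.pow_le_pow_right hα (Nat.lt_succ_iff.1 (mem_range.1 hj))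
    _ = (m + 1) * (Fintype.card α) ^ m := by rw [sum_const, card_range, smul_eq_mul]

/-- For `n ≥ 1` there is at least one unordered pair over `Fin n`. -/
theorem one_le_card_sym2_fin {n : ℕ} (hn : 1 ≤ n) : 1 ≤ Fintype.card (Sym2 (Fin n)) := by
  rw [Sym2.card, Fintype.card_fin]
  exact Nat.choose_pos (by omega)

/-! ### Superset rectangles: every non-3-colourable `H` gives `μ{G ⊇ H} ≤ δ` -/

section Superset

variable {V : Type*} [Fintype V] [DecidableEq V]

omit [Fintype V] [DecidableEq V] in
/-- Non-3-colourability is monotone under adding edges. -/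
theorem not_colorable_of_subset {H K : Finset (Sym2 V)} (hHK : H ⊆ K)
    (hH : ¬ (SimpleGraph.fromEdgeSet (H : Set (Sym2 V))).Colorable 3) :
    ¬ (SimpleGraph.fromEdgeSet (K : Set (Sym2 V))).Colorable 3 :=
  fun hK => hH (hK.mono_left (SimpleGraph.fromEdgeSet_mono (Finset.coe_subset.2 hHK)))

/-- **The superset rectangle.**  For `μ ≥ 0` supported on loopless non-3-colourable edge sets, a cut `B`
and a non-3-colourable edge set `H`, there is a cut rectangle over `B` inside NON-3-COL (X1's three
hypotheses verbatim: Alice parts loopless meeting `V ∖ B`, Bob parts loopless inside `B`, all unions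
non-3-colourable) whose mass is at least `μ{G : H ⊆ G}`.  (Alice parts: the outside parts of the supersets
of `H` carrying mass; Bob parts: their inside parts; every union contains `H`.) -/
theorem supset_sum_le_rect (μ : Finset (Sym2 V) → ℝ) (hμ : ∀ S, 0 ≤ μ S)
    (hs : ∀ S, μ S ≠ 0 → (∀ e ∈ S, ¬ e.IsDiag) ∧
      ¬ (SimpleGraph.fromEdgeSet (S : Set (Sym2 V))).Colorable 3)
    (B : Finset V) {H : Finset (Sym2 V)}
    (hH : ¬ (SimpleGraph.fromEdgeSet (H : Set (Sym2 V))).Colorable 3) :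
    ∃ 𝓐 𝓑 : Finset (Finset (Sym2 V)),
      (∀ α ∈ 𝓐, ∀ e ∈ α, ¬ e.IsDiag ∧ ∃ v ∈ e, v ∉ B) ∧
      (∀ β ∈ 𝓑, ∀ e ∈ β, ¬ e.IsDiag ∧ ∀ v ∈ e, v ∈ B) ∧
      (∀ α ∈ 𝓐, ∀ β ∈ 𝓑,
        ¬ (SimpleGraph.fromEdgeSet ((α ∪ β : Finset (Sym2 V)) : Set (Sym2 V))).Colorable 3) ∧
      ∑ G ∈ univ.filter (fun G => H ⊆ G), μ G ≤ ∑ q ∈ 𝓐 ×ˢ 𝓑, μ (q.1 ∪ q.2) := by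
  classical
  set T : Finset (Finset (Sym2 V)) := univ.filter (fun G => H ⊆ G) with hT
  set F : Finset (Finset (Sym2 V)) := T.filter (fun G => μ G ≠ 0) with hF
  refine ⟨F.image (aliceSide B), F.image (bobSide B), ?_, ?_, ?_, ?_⟩
  · intro α hα e he
    obtain ⟨G, hG, rfl⟩ := mem_image.1 hα
    obtain ⟨heG, hout⟩ := mem_aliceSide.1 he
    exact ⟨(hs G (mem_filter.1 hG).2).1 e heG, hout⟩
  · intro β hβ e he
    obtain ⟨G, hG, rfl⟩ := mem_image.1 hβ
    obtain ⟨heG, hin⟩ := mem_bobSide.1 he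
    exact ⟨(hs G (mem_filter.1 hG).2).1 e heG, hin⟩
  · intro α hα β hβ
    obtain ⟨G, hG, rfl⟩ := mem_image.1 hα
    obtain ⟨G', hG', rfl⟩ := mem_image.1 hβ
    have hHG : H ⊆ G := (mem_filter.1 (mem_filter.1 hG).1).2
    have hHG' : H ⊆ G' := (mem_filter.1 (mem_filter.1 hG').1).2
    refine not_colorable_of_subset (fun e he => ?_) hH
    by_cases hin : ∀ v ∈ e, v ∈ B
    · exact mem_union.2 (Or.inr (mem_bobSide.2 ⟨hHG' he, hin⟩))
    · push Not at hin
      exact mem_union.2 (Or.inl (mem_aliceSide.2 ⟨hHG he, hin⟩))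
  · have hinj : ∀ G ∈ F, ∀ G' ∈ F,
        (aliceSide B G, bobSide B G) = (aliceSide B G', bobSide B G') → G = G' := by
      intro G _ G' _ h
      have h1 : aliceSide B G = aliceSide B G' := congrArg Prod.fst h
      have h2 : bobSide B G = bobSide B G' := congrArg Prod.snd h
      rw [← aliceSide_union_bobSide B G, ← aliceSide_union_bobSide B G', h1, h2]
    calc ∑ G ∈ T, μ G = ∑ G ∈ F, μ G := (sum_filter_ne_zero T).symm
      _ = ∑ G ∈ F, μ ((aliceSide B G, bobSide B G).1 ∪ (aliceSide B G, bobSide B G).2) := by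
          refine sum_congr rfl fun G _ => ?_
          show μ G = μ (aliceSide B G ∪ bobSide B G)
          rw [aliceSide_union_bobSide]
      _ = ∑ q ∈ F.image (fun G => (aliceSide B G, bobSide B G)), μ (q.1 ∪ q.2) := by
          rw [sum_image hinj]
      _ ≤ ∑ q ∈ F.image (aliceSide B) ×ˢ F.image (bobSide B), μ (q.1 ∪ q.2) := by
          apply sum_le_sum_of_subset_of_nonneg
          · intro q hq
            obtain ⟨G, hG, rfl⟩ := mem_image.1 hq
            exact mem_product.2 ⟨mem_image_of_mem _ hG, mem_image_of_mem _ hG⟩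
          · intro q _ _
            exact hμ _

/-- **Superset bound.**  X1's rectangle clause at the cut `B` with bound `δ` forces `μ{G : H ⊆ G} ≤ δ` for
every non-3-colourable edge set `H`. -/
theorem supset_le_of_rectClause (μ : Finset (Sym2 V) → ℝ) (hμ : ∀ S, 0 ≤ μ S)
    (hs : ∀ S, μ S ≠ 0 → (∀ e ∈ S, ¬ e.IsDiag) ∧
      ¬ (SimpleGraph.fromEdgeSet (S : Set (Sym2 V))).Colorable 3)
    {B : Finset V} {δ : ℝ}
    (hclause : ∀ 𝓐 𝓑 : Finset (Finset (Sym2 V)),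
      (∀ α ∈ 𝓐, ∀ e ∈ α, ¬ e.IsDiag ∧ ∃ v ∈ e, v ∉ B) →
      (∀ β ∈ 𝓑, ∀ e ∈ β, ¬ e.IsDiag ∧ ∀ v ∈ e, v ∈ B) →
      (∀ α ∈ 𝓐, ∀ β ∈ 𝓑,
        ¬ (SimpleGraph.fromEdgeSet ((α ∪ β : Finset (Sym2 V)) : Set (Sym2 V))).Colorable 3) →
      ∑ q ∈ 𝓐 ×ˢ 𝓑, μ (q.1 ∪ q.2) ≤ δ)
    {H : Finset (Sym2 V)} (hH : ¬ (SimpleGraph.fromEdgeSet (H : Set (Sym2 V))).Colorable 3) :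
    ∑ G ∈ univ.filter (fun G => H ⊆ G), μ G ≤ δ := by
  obtain ⟨𝓐, 𝓑, h𝓐, h𝓑, hN, hle⟩ := supset_sum_le_rect μ hμ hs B hH
  exact hle.trans (hclause 𝓐 𝓑 h𝓐 h𝓑 hN)

/-- **Sparse obstructions.**  If every support graph of `μ` contains a non-3-colourable edge set with `≤ m`
edges, then X1's clause at one cut `B` with bound `δ` forces the TOTAL mass to be at most
`#{H : |H| ≤ m} · δ` (union bound over the superset rectangles). -/
theorem total_le_of_sparseObstructions (μ : Finset (Sym2 V) → ℝ) (hμ : ∀ S, 0 ≤ μ S)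
    (hs : ∀ S, μ S ≠ 0 → (∀ e ∈ S, ¬ e.IsDiag) ∧
      ¬ (SimpleGraph.fromEdgeSet (S : Set (Sym2 V))).Colorable 3)
    {B : Finset V} {δ : ℝ}
    (hclause : ∀ 𝓐 𝓑 : Finset (Finset (Sym2 V)),
      (∀ α ∈ 𝓐, ∀ e ∈ α, ¬ e.IsDiag ∧ ∃ v ∈ e, v ∉ B) →
      (∀ β ∈ 𝓑, ∀ e ∈ β, ¬ e.IsDiag ∧ ∀ v ∈ e, v ∈ B) →
      (∀ α ∈ 𝓐, ∀ β ∈ 𝓑,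
        ¬ (SimpleGraph.fromEdgeSet ((α ∪ β : Finset (Sym2 V)) : Set (Sym2 V))).Colorable 3) →
      ∑ q ∈ 𝓐 ×ˢ 𝓑, μ (q.1 ∪ q.2) ≤ δ)
    (m : ℕ)
    (hrestr : ∀ S, μ S ≠ 0 → ∃ H, H ⊆ S ∧ H.card ≤ m ∧
      ¬ (SimpleGraph.fromEdgeSet (H : Set (Sym2 V))).Colorable 3) :
    ∑ S, μ S ≤ (((univ : Finset (Finset (Sym2 V))).filter (fun H => H.card ≤ m)).card : ℝ) * δ := by
  classical
  set P : Finset (Finset (Sym2 V)) := univ.filter (fun H => H.card ≤ m) with hP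
  set I : Finset (Finset (Sym2 V)) :=
    P.filter (fun H => ¬ (SimpleGraph.fromEdgeSet (H : Set (Sym2 V))).Colorable 3) with hI
  have hcov : ∀ S, μ S ≠ 0 → ∃ H ∈ I, H ⊆ S := by
    intro S hS
    obtain ⟨H, hHS, hcard, hH⟩ := hrestr S hS
    exact ⟨H, mem_filter.2 ⟨mem_filter.2 ⟨mem_univ _, hcard⟩, hH⟩, hHS⟩
  have hδ : 0 ≤ δ := by
    have h := hclause ∅ ∅ (by simp) (by simp) (by simp)
    simpa using h
  calc ∑ S, μ S ≤ ∑ H ∈ I, ∑ S ∈ univ.filter (fun S => H ⊆ S), μ S :=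
        sum_le_sum_cover I (fun H S => H ⊆ S) μ hμ hcov
    _ ≤ ∑ _H ∈ I, δ :=
        sum_le_sum fun H hH => supset_le_of_rectClause μ hμ hs hclause (mem_filter.1 hH).2
    _ = (I.card : ℝ) * δ := by rw [sum_const, nsmul_eq_mul]
    _ ≤ (P.card : ℝ) * δ := by
        have : I.card ≤ P.card := card_le_card (filter_subset _ _)
        exact mul_le_mul_of_nonneg_right (by exact_mod_cast this) hδ

/-! ### Sparse fibres: `μ{G : |G[B]| ≤ m} ≤ #{β : |β| ≤ m} · δ` -/

/-- **Sparse Bob sides.**  X1's clause at the cut `B` with bound `δ` forces the mass of the graphs with at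
most `m` edges inside `B` to be at most `#{β : |β| ≤ m} · δ` (the Bob-fibres of
`AeaCutRectanglesFibreBound`, summed). -/
theorem sparseBob_le (μ : Finset (Sym2 V) → ℝ) (hμ : ∀ S, 0 ≤ μ S)
    (hs : ∀ S, μ S ≠ 0 → (∀ e ∈ S, ¬ e.IsDiag) ∧
      ¬ (SimpleGraph.fromEdgeSet (S : Set (Sym2 V))).Colorable 3)
    {B : Finset V} {δ : ℝ}
    (hclause : ∀ 𝓐 𝓑 : Finset (Finset (Sym2 V)),
      (∀ α ∈ 𝓐, ∀ e ∈ α, ¬ e.IsDiag ∧ ∃ v ∈ e, v ∉ B) →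
      (∀ β ∈ 𝓑, ∀ e ∈ β, ¬ e.IsDiag ∧ ∀ v ∈ e, v ∈ B) →
      (∀ α ∈ 𝓐, ∀ β ∈ 𝓑,
        ¬ (SimpleGraph.fromEdgeSet ((α ∪ β : Finset (Sym2 V)) : Set (Sym2 V))).Colorable 3) →
      ∑ q ∈ 𝓐 ×ˢ 𝓑, μ (q.1 ∪ q.2) ≤ δ)
    (m : ℕ) :
    ∑ G ∈ univ.filter (fun G => (bobSide B G).card ≤ m), μ G ≤
      (((univ : Finset (Finset (Sym2 V))).filter (fun H => H.card ≤ m)).card : ℝ) * δ := by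
  classical
  set P : Finset (Finset (Sym2 V)) := univ.filter (fun H => H.card ≤ m) with hP
  have hsub : univ.filter (fun G => (bobSide B G).card ≤ m) ⊆ P.biUnion (fun β => bobFibre B β) := by
    intro G hG
    exact mem_biUnion.2 ⟨bobSide B G, mem_filter.2 ⟨mem_univ _, (mem_filter.1 hG).2⟩,
      mem_bobFibre.2 rfl⟩
  have hdisj : (P : Set (Finset (Sym2 V))).PairwiseDisjoint (fun β => bobFibre B β) := by
    intro β _ β' _ hne
    rw [Function.onFun, disjoint_left]
    intro G hG hG'
    exact hne ((mem_bobFibre.1 hG).symm.trans (mem_bobFibre.1 hG'))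
  calc ∑ G ∈ univ.filter (fun G => (bobSide B G).card ≤ m), μ G
      ≤ ∑ G ∈ P.biUnion (fun β => bobFibre B β), μ G :=
        sum_le_sum_of_subset_of_nonneg hsub fun G _ _ => hμ G
    _ = ∑ β ∈ P, ∑ G ∈ bobFibre B β, μ G := sum_biUnion hdisj
    _ ≤ ∑ _β ∈ P, δ := sum_le_sum fun β _ => bobFibre_le_of_rectClause μ hs hclause β
    _ = (P.card : ℝ) * δ := by rw [sum_const, nsmul_eq_mul]

/-- **Sparse near-halves.**  If every support graph of `μ` has a cut in the window `W` with at most `m`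
inside edges, and X1's clause holds with bound `δ ≥ 0` at every cut of the window, then the TOTAL mass is at
most `2^{|V|} · #{β : |β| ≤ m} · δ` (union bound over cuts and sparse fibres). -/
theorem total_le_of_sparseHalf (μ : Finset (Sym2 V) → ℝ) (hμ : ∀ S, 0 ≤ μ S)
    (hs : ∀ S, μ S ≠ 0 → (∀ e ∈ S, ¬ e.IsDiag) ∧
      ¬ (SimpleGraph.fromEdgeSet (S : Set (Sym2 V))).Colorable 3)
    (W : Finset V → Prop) [DecidablePred W] {δ : ℝ} (hδ : 0 ≤ δ)
    (hclause : ∀ B, W B → ∀ 𝓐 𝓑 : Finset (Finset (Sym2 V)),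
      (∀ α ∈ 𝓐, ∀ e ∈ α, ¬ e.IsDiag ∧ ∃ v ∈ e, v ∉ B) →
      (∀ β ∈ 𝓑, ∀ e ∈ β, ¬ e.IsDiag ∧ ∀ v ∈ e, v ∈ B) →
      (∀ α ∈ 𝓐, ∀ β ∈ 𝓑,
        ¬ (SimpleGraph.fromEdgeSet ((α ∪ β : Finset (Sym2 V)) : Set (Sym2 V))).Colorable 3) →
      ∑ q ∈ 𝓐 ×ˢ 𝓑, μ (q.1 ∪ q.2) ≤ δ)
    (m : ℕ) (hrestr : ∀ S, μ S ≠ 0 → ∃ B, W B ∧ (bobSide B S).card ≤ m) :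
    ∑ S, μ S ≤ ((2 ^ Fintype.card V : ℕ) : ℝ) *
      ((((univ : Finset (Finset (Sym2 V))).filter (fun H => H.card ≤ m)).card : ℝ) * δ) := by
  classical
  set P : Finset (Finset (Sym2 V)) := univ.filter (fun H => H.card ≤ m) with hP
  set Wset : Finset (Finset V) := univ.filter W with hWset
  have hcov : ∀ S, μ S ≠ 0 → ∃ B ∈ Wset, (bobSide B S).card ≤ m := by
    intro S hS
    obtain ⟨B, hB, hc⟩ := hrestr S hS
    exact ⟨B, mem_filter.2 ⟨mem_univ _, hB⟩, hc⟩
  calc ∑ S, μ S ≤ ∑ B ∈ Wset, ∑ S ∈ univ.filter (fun S => (bobSide B S).card ≤ m), μ S :=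
        sum_le_sum_cover Wset (fun B S => (bobSide B S).card ≤ m) μ hμ hcov
    _ ≤ ∑ _B ∈ Wset, (P.card : ℝ) * δ :=
        sum_le_sum fun B hB => sparseBob_le μ hμ hs (hclause B (mem_filter.1 hB).2) m
    _ = (Wset.card : ℝ) * ((P.card : ℝ) * δ) := by rw [sum_const, nsmul_eq_mul]
    _ ≤ ((2 ^ Fintype.card V : ℕ) : ℝ) * ((P.card : ℝ) * δ) := by
        have h1 : Wset.card ≤ 2 ^ Fintype.card V := by
          calc Wset.card ≤ (univ : Finset (Finset V)).card := card_le_card (filter_subset _ _)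
            _ = 2 ^ Fintype.card V := by rw [card_univ, Fintype.card_finset]
        exact mul_le_mul_of_nonneg_right (by exact_mod_cast h1) (mul_nonneg (by positivity) hδ)

omit [Fintype V] in
/-- `K₄` is not 3-colourable: the six edges on four distinct vertices form a non-3-colourable edge set. -/
theorem K4_not_colorable {a b c d : V} (hab : a ≠ b) (hac : a ≠ c) (had : a ≠ d) (hbc : b ≠ c)
    (hbd : b ≠ d) (hcd : c ≠ d) :
    ¬ (SimpleGraph.fromEdgeSet
      (({s(a, b), s(a, c), s(a, d), s(b, c), s(b, d), s(c, d)} : Finset (Sym2 V)) : Set (Sym2 V))).Colorable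
        3 := by
  rintro ⟨col⟩
  set K : Finset (Sym2 V) := {s(a, b), s(a, c), s(a, d), s(b, c), s(b, d), s(c, d)} with hK
  have hadj : ∀ {x y : V}, s(x, y) ∈ K → x ≠ y →
      (SimpleGraph.fromEdgeSet ((K : Finset (Sym2 V)) : Set (Sym2 V))).Adj x y :=
    fun hxy hne => (SimpleGraph.fromEdgeSet_adj _).2 ⟨mem_coe.2 hxy, hne⟩
  have h1 := Fin.val_ne_of_ne (col.valid (hadj (by simp [hK]) hab))
  have h2 := Fin.val_ne_of_ne (col.valid (hadj (by simp [hK]) hac))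
  have h3 := Fin.val_ne_of_ne (col.valid (hadj (by simp [hK]) had))
  have h4 := Fin.val_ne_of_ne (col.valid (hadj (by simp [hK]) hbc))
  have h5 := Fin.val_ne_of_ne (col.valid (hadj (by simp [hK]) hbd))
  have h6 := Fin.val_ne_of_ne (col.valid (hadj (by simp [hK]) hcd))
  have := (col a).isLt
  have := (col b).isLt
  have := (col c).isLt
  have := (col d).isLt
  omega

end Superset

/-! ### Threshold arithmetic -/

/-- `2^{(n/2)·log₂ n} = n^{n/2}`. -/
theorem two_rpow_half_logb {n : ℕ} (hn : 1 ≤ n) :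
    (2 : ℝ) ^ ((n : ℝ) / 2 * Real.logb 2 n) = (n : ℝ) ^ ((n : ℝ) / 2) := by
  have hn0 : (0 : ℝ) < n := by exact_mod_cast hn
  rw [mul_comm, Real.rpow_mul (by norm_num), Real.rpow_logb (by norm_num) (by norm_num) hn0]

/-- **The count beats the threshold.**  For `4(m+1) ≤ n`:  `(m+1)·(n²)^m · 2^{-(n/2)·log₂ n} < 1`
(indeed `(m+1)(n²)^m ≤ n^{2m+1} < n^{2m+2} ≤ n^{n/2}`). -/
theorem count_mul_threshold_lt_one {n m : ℕ} (hn : 4 ≤ n) (hm : 4 * (m + 1) ≤ n) :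
    (((m + 1 : ℕ) : ℝ) * ((n : ℝ) ^ 2) ^ m) * (2 : ℝ) ^ (-((n : ℝ) / 2 * Real.logb 2 n)) < 1 := by
  have hn1 : (1 : ℝ) < n := by exact_mod_cast (show 1 < n by omega)
  have hn0 : (0 : ℝ) < n := by linarith
  have hA : (0 : ℝ) < (n : ℝ) ^ ((n : ℝ) / 2) := Real.rpow_pos_of_pos hn0 _
  -- the count is at most n^{2m+1}
  have hcount : ((m + 1 : ℕ) : ℝ) * ((n : ℝ) ^ 2) ^ m ≤ (n : ℝ) ^ (2 * m + 1) := by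
    have hm1 : ((m + 1 : ℕ) : ℝ) ≤ n := by exact_mod_cast (show m + 1 ≤ n by omega)
    rw [← pow_mul, pow_succ, mul_comm]
    exact mul_le_mul_of_nonneg_left hm1 (by positivity)
  -- n^{2m+1} < n^{2m+2} ≤ n^{n/2}
  have hlt : (n : ℝ) ^ (2 * m + 1) < (n : ℝ) ^ (2 * m + 2) := pow_lt_pow_right₀ hn1 (by omega)
  have hle : (n : ℝ) ^ (2 * m + 2) ≤ (n : ℝ) ^ ((n : ℝ) / 2) := by
    rw [← Real.rpow_natCast]
    apply Real.rpow_le_rpow_of_exponent_le hn1.le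
    have : ((4 * (m + 1) : ℕ) : ℝ) ≤ n := by exact_mod_cast hm
    push_cast at this ⊢
    linarith
  rw [Real.rpow_neg (by norm_num), two_rpow_half_logb (by omega)]
  calc (((m + 1 : ℕ) : ℝ) * ((n : ℝ) ^ 2) ^ m) * ((n : ℝ) ^ ((n : ℝ) / 2))⁻¹
      < (n : ℝ) ^ ((n : ℝ) / 2) * ((n : ℝ) ^ ((n : ℝ) / 2))⁻¹ :=
        mul_lt_mul_of_pos_right (lt_of_le_of_lt hcount (lt_of_lt_of_le hlt hle)) (inv_pos.2 hA)
    _ = 1 := mul_inv_cancel₀ hA.ne'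

/-- The number of edge sets over `Fin n` with at most `m` edges is at most `(m+1)·(n²)^m` (for `n ≥ 1`). -/
theorem card_small_edgeSets_le {n : ℕ} (hn : 1 ≤ n) (m : ℕ) :
    (((univ : Finset (Finset (Sym2 (Fin n)))).filter (fun H => H.card ≤ m)).card : ℝ) ≤
      ((m + 1 : ℕ) : ℝ) * ((n : ℝ) ^ 2) ^ m := by
  have h1 := card_filter_card_le (Sym2 (Fin n)) m (one_le_card_sym2_fin hn)
  have h2 : (m + 1) * (Fintype.card (Sym2 (Fin n))) ^ m ≤ (m + 1) * (n ^ 2) ^ m :=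
    Nat.mul_le_mul_left _ (Nat.pow_le_pow_left (Literature.Barriers.PneNP.card_sym2_fin_le n) m)
  exact_mod_cast h1.trans h2

end Summit.PneNP.PneNP.Theorems.AeaCutRectanglesSparseWitnesses
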